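import Summits.QuantumFields.YangMills.Theorems.BalabanLadderIRTwistedSlabGaugeOrbitData
import Literature.Analysis.Asymptotics.LaplaceMethodSeveralOrbits
import HarnessLib

/-!
# Tube topology for the Laplace assembly on the twisted slab: the left exponential coordinates and the orbit map are OPEN near the origin,
# the fibred chart is open at every point of a window (`𝓝 (Ψ q) ≤ map Ψ (𝓝 q)`), orbit tubes are open, and the `N²` vacuum orbits have
# pairwise separated tubes — the topological inputs of lit-4's L21 `isOpen_tube_of_isOpen_image` ∕ `exists_pos_forall_act_ne` ∕
# `tendsto_laplaceMethod_sum_of_tubes` (∕ L23) BY NAME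

HELPER toward stub **T1** `TwistedSlabAnchor` (LINE `twisted-slab-continuity`, crux `IRcof` stmt-QuantumFields-26930, census row 43;
LEAD prover ym-ir-line-tsc-p1 g4; `--supports` the crux, `--as helper`).  Sequel of `…TwistedSlabGaugeOrbitData` (K21).  Proof file: theorems only,
no definitions, no named facts.  Norm scope `Matrix.Norms.Frobenius` (K15's chart currency); conclusions are topological (cross scopes).
* §1 ★★ `exists_isOpen_forall_isOpen_expMul_image` (any `L ∈ SU(N)^E`): an open `W ∋ 0` in `Fin 4 → suFields` such that the left exponential coordinates
  `Y ↦ e^{Y}·L` map every open `O ⊆ W` to an OPEN set of configurations (local inverse `U ↦ (log(U(e)L(e)ᴴ))_e`, `𝔰𝔲`-valued and continuous on a window,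
  via K15c `suProj`, Federbush's lemma and Liouville's formula — K21 `mlog_skew_traceless_of_mem_specialUnitaryGroup`).
* §2 ★★ `exists_isOpen_forall_isOpen_orbitCfg_image` (twist-eating ladder): the orbit map `(φ, y) ↦ e^{φ} • (e^{y}·L)` is OPEN near `0` (IFT chart K15b
  `sliceChart` + §1 + K15b `eventually_exp_slicePsiSu_mul`); `exists_isOpen_forall_nhds_le_map_orbitCfg` (`𝓝 (orbitCfg q) ≤ map orbitCfg (𝓝 q)` on a window).
* §3 ★ `exists_isOpen_forall_isOpen_fibredChartMap_image` ∕ `exists_isOpen_forall_nhds_le_map_fibredChartMap` (the same for the fibred chart map `Ψ` on any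
  `L²`-product model `M × V`, any frame `T`).
* §4 ★★ `isOpen_tube_of_subset` (the orbit tube `Θ(𝒢 × B) = {k • σ(T_V y)}` is OPEN once `Φ ×ˢ B` lies in the window, `0 ∈ Φ`: L21 `isOpen_tube_of_isOpen_image`
  with `U := e(Φ) ∋ 1` and K18 `fibredChartMap_prodFrame`), `mem_tube_of_gaugeAct_sliceCfg`.
* §5 ★ `exists_pos_forall_gaugeAct_sliceCfg_ne` (two DISTINCT centre labels `(i, j) ≠ (i′, j′)` ⇒ a radius below which the two tubes are disjoint:
  K2 `ladder_pair_labels_unique_specialUnitary` + L21 §3b `exists_pos_forall_act_ne` on the compact gauge group).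
NOT here (honest scope): the slice property and `hsep` on the slice annulus (next file, with L17 §4), the L18 ∕ L21 call; anything uniform in `β` (M3);
the cluster expansion (M4); T1-box 0∕1, T1 proper 0∕1.

HONEST FRAMING: point-set topology on one box; nothing here bears on `IRcof`, `IR`, or the Yang–Mills mass gap (Clay: NOT proved); R4 =
`BalabanLadder.UV` only.  References: G. E. Bredon, *Introduction to Compact Transformation Groups* (1972) Ch. II §§4–5; S. Helgason, *Groups and
Geometric Analysis* Ch. I §1 Thm 1.14; E. Hasenpflug, D. Rudolf, B. Sprungk (2024) §3.1 Assumption 3 (T).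
-/

set_option autoImplicit false

noncomputable section

open scoped Matrix Matrix.Norms.Frobenius Topology
open MeasureTheory Filter NormedSpace Set WithLp
open Literature.MathematicalPhysics.QuantumFieldTheory Literature.MathematicalPhysics.QuantumLattice
open Literature.MathematicalPhysics.QuantumFieldTheory.Balaban1983to89.MatrixLog (mlog exp_mlog analyticAt_mlog)
open Literature.MathematicalPhysics.QuantumFieldTheory.Balaban1983to89.B7BlockAvgLog (mlog_exp)
open Literature.Analysis.Asymptotics

namespace Summit.QuantumFields.YangMills.Cruxes.IRcof.TwistedSlab

variable {N : ℕ} {n₀ n₁ n₂ n₃ : ℕ}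

/-! ## §1 Left exponential coordinates around a background are open -/

section ExpMul

variable [NeZero N] {L : FinTorusSite n₀ n₁ n₂ n₃ × Fin 4 → Matrix (Fin N) (Fin N) ℂ}

/-- ★★ **LEFT EXPONENTIAL COORDINATES AROUND A BACKGROUND ARE OPEN**: for `L ∈ SU(N)^E` there is an open `W ∋ 0` in `Fin 4 → suFields` such that for
every open `O ⊆ W` the set of configurations `{U | ∃ Y ∈ O, U(e) = e^{Y(e)}·L(e) ∀ e}` (the image of `O` under `Y ↦ e^{Y}·L`) is OPEN in `SU(N)^E`
(local inverse `U ↦ (log(U(e)L(e)ᴴ))_e`, `𝔰𝔲(N)`-valued and continuous on a window around `L`). [cite: Helgason2000, Ch. I §1 Thm 1.14 p. 96] -/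
theorem exists_isOpen_forall_isOpen_expMul_image (hL : ∀ e, L e ∈ Matrix.specialUnitaryGroup (Fin N) ℂ) :
    ∃ W : Set (Fin 4 → suFields N n₀ n₁ n₂ n₃), IsOpen W ∧ (0 : Fin 4 → suFields N n₀ n₁ n₂ n₃) ∈ W ∧
      ∀ O ⊆ W, IsOpen O → IsOpen {U : FinTorusSite n₀ n₁ n₂ n₃ × Fin 4 → Matrix.specialUnitaryGroup (Fin N) ℂ |
        ∃ Y ∈ O, ∀ e, ((U e : Matrix.specialUnitaryGroup (Fin N) ℂ) : Matrix (Fin N) (Fin N) ℂ) =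
          exp (((Y e.2 : suFields N n₀ n₁ n₂ n₃) : FinTorusSite n₀ n₁ n₂ n₃ → Matrix (Fin N) (Fin N) ℂ) e.1) * L e} := by
  have hLu : ∀ e, L e ∈ Matrix.unitaryGroup (Fin N) ℂ := fun e => (Matrix.mem_specialUnitaryGroup_iff.1 (hL e)).1
  have hLL : ∀ e, L e * (L e)ᴴ = 1 := fun e => by
    have h := Matrix.mem_unitaryGroup_iff.1 (hLu e); rwa [Matrix.star_eq_conjTranspose] at h
  have hLL' : ∀ e, (L e)ᴴ * L e = 1 := fun e => by
    have h := Matrix.mem_unitaryGroup_iff'.1 (hLu e); rwa [Matrix.star_eq_conjTranspose] at h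
  -- the left fluctuation `W_e(U) = ↑(U e) · L(e)ᴴ` and the window `Ω`
  set fl : (FinTorusSite n₀ n₁ n₂ n₃ × Fin 4 → Matrix.specialUnitaryGroup (Fin N) ℂ) → (FinTorusSite n₀ n₁ n₂ n₃ × Fin 4) →
      Matrix (Fin N) (Fin N) ℂ := fun U e => ((U e : Matrix.specialUnitaryGroup (Fin N) ℂ) : Matrix (Fin N) (Fin N) ℂ) * (L e)ᴴ with hfl
  have hflc : ∀ e, Continuous fun U : FinTorusSite n₀ n₁ n₂ n₃ × Fin 4 → Matrix.specialUnitaryGroup (Fin N) ℂ => fl U e := fun e =>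
    (continuous_subtype_val.comp (continuous_apply e)).mul continuous_const
  set Ω : Set (FinTorusSite n₀ n₁ n₂ n₃ × Fin 4 → Matrix.specialUnitaryGroup (Fin N) ℂ) :=
    {U | ∀ e, ‖fl U e - 1‖ < 1 / 4 ∧ ‖(mlog (fl U e)).trace‖ < 2 * Real.pi} with hΩ
  have hΩ₁ : IsOpen {U : FinTorusSite n₀ n₁ n₂ n₃ × Fin 4 → Matrix.specialUnitaryGroup (Fin N) ℂ | ∀ e, ‖fl U e - 1‖ < 1 / 4} := by
    rw [show {U : FinTorusSite n₀ n₁ n₂ n₃ × Fin 4 → Matrix.specialUnitaryGroup (Fin N) ℂ | ∀ e, ‖fl U e - 1‖ < 1 / 4} =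
      ⋂ e, {U | ‖fl U e - 1‖ < 1 / 4} by ext U; simp only [mem_setOf_eq, mem_iInter]]
    exact isOpen_iInter_of_finite fun e => isOpen_lt ((hflc e).sub continuous_const).norm continuous_const
  have hlogc : ∀ e, ContinuousOn (fun U : FinTorusSite n₀ n₁ n₂ n₃ × Fin 4 → Matrix.specialUnitaryGroup (Fin N) ℂ => mlog (fl U e))
      {U | ∀ e, ‖fl U e - 1‖ < 1 / 4} := by
    intro e U hU
    have h1 : ‖fl U e - 1‖ < 1 := by linarith [hU e]
    exact ((analyticAt_mlog h1).continuousAt.comp_of_eq (hflc e).continuousAt rfl).continuousWithinAt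
  have hΩo : IsOpen Ω := by
    have h : Ω = {U | ∀ e, ‖fl U e - 1‖ < 1 / 4} ∩ ⋂ e, {U | U ∈ {U | ∀ e, ‖fl U e - 1‖ < 1 / 4} ∧
        (fun U => mlog (fl U e)) U ∈ {M : Matrix (Fin N) (Fin N) ℂ | ‖M.trace‖ < 2 * Real.pi}} := by
      ext U
      simp only [hΩ, mem_setOf_eq, mem_inter_iff, mem_iInter]
      constructor
      · intro h; exact ⟨fun e => (h e).1, fun e => ⟨fun e' => (h e').1, (h e).2⟩⟩
      · intro h e; exact ⟨h.1 e, (h.2 e).2⟩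
    rw [h]
    refine hΩ₁.inter (isOpen_iInter_of_finite fun e => ?_)
    exact (hlogc e).isOpen_inter_preimage hΩ₁ (isOpen_lt (continuous_id.matrix_trace.norm) continuous_const)
  -- the local inverse `Λ U = suProj ((μ, x) ↦ log W_{(x,μ)}(U))`, continuous on `Ω`
  set Λ : (FinTorusSite n₀ n₁ n₂ n₃ × Fin 4 → Matrix.specialUnitaryGroup (Fin N) ℂ) → (Fin 4 → suFields N n₀ n₁ n₂ n₃) :=
    fun U => suProj N n₀ n₁ n₂ n₃ (fun μ x => mlog (fl U (x, μ))) with hΛ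
  have hΛc : ContinuousOn Λ Ω := by
    refine (suProj N n₀ n₁ n₂ n₃).continuous.comp_continuousOn ?_
    refine continuousOn_pi.2 fun μ => continuousOn_pi.2 fun x => ?_
    exact (hlogc (x, μ)).mono fun U hU e => (hU e).1
  -- the window in `Y`-space
  set W : Set (Fin 4 → suFields N n₀ n₁ n₂ n₃) := {Y | (∀ e : FinTorusSite n₀ n₁ n₂ n₃ × Fin 4, ‖exp (((Y e.2 : suFields N n₀ n₁ n₂ n₃) :
      FinTorusSite n₀ n₁ n₂ n₃ → Matrix (Fin N) (Fin N) ℂ) e.1) - 1‖ < 1 / 4 ∧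
        ‖(mlog (exp (((Y e.2 : suFields N n₀ n₁ n₂ n₃) : FinTorusSite n₀ n₁ n₂ n₃ → Matrix (Fin N) (Fin N) ℂ) e.1))).trace‖ < 2 * Real.pi) ∧
      ∀ e : FinTorusSite n₀ n₁ n₂ n₃ × Fin 4, ‖((Y e.2 : suFields N n₀ n₁ n₂ n₃) : FinTorusSite n₀ n₁ n₂ n₃ → Matrix (Fin N) (Fin N) ℂ) e.1‖ < Real.log 2} with hW
  have hevc : ∀ e : FinTorusSite n₀ n₁ n₂ n₃ × Fin 4, Continuous fun Y : Fin 4 → suFields N n₀ n₁ n₂ n₃ =>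
      ((Y e.2 : suFields N n₀ n₁ n₂ n₃) : FinTorusSite n₀ n₁ n₂ n₃ → Matrix (Fin N) (Fin N) ℂ) e.1 := fun e =>
    (continuous_apply e.1).comp (continuous_subtype_val.comp (continuous_apply e.2))
  have hWo : IsOpen W := by
    letI : NormedAlgebra ℚ (Matrix (Fin N) (Fin N) ℂ) := NormedAlgebra.restrictScalars ℚ ℂ (Matrix (Fin N) (Fin N) ℂ)
    have h : W = (⋂ e : FinTorusSite n₀ n₁ n₂ n₃ × Fin 4, {Y | ‖exp (((Y e.2 : suFields N n₀ n₁ n₂ n₃) : FinTorusSite n₀ n₁ n₂ n₃ → Matrix (Fin N) (Fin N) ℂ) e.1) - 1‖ < 1 / 4} ∩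
        {Y | Y ∈ {Y | ‖exp (((Y e.2 : suFields N n₀ n₁ n₂ n₃) : FinTorusSite n₀ n₁ n₂ n₃ → Matrix (Fin N) (Fin N) ℂ) e.1) - 1‖ < 1 / 4} ∧
          (fun Y => mlog (exp (((Y e.2 : suFields N n₀ n₁ n₂ n₃) : FinTorusSite n₀ n₁ n₂ n₃ → Matrix (Fin N) (Fin N) ℂ) e.1))) Y ∈
            {M : Matrix (Fin N) (Fin N) ℂ | ‖M.trace‖ < 2 * Real.pi}}) ∩
        ⋂ e : FinTorusSite n₀ n₁ n₂ n₃ × Fin 4, {Y | ‖((Y e.2 : suFields N n₀ n₁ n₂ n₃) : FinTorusSite n₀ n₁ n₂ n₃ → Matrix (Fin N) (Fin N) ℂ) e.1‖ < Real.log 2} := by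
      ext Y
      simp only [hW, mem_setOf_eq, mem_inter_iff, mem_iInter]
      constructor
      · rintro ⟨h1, h2⟩; exact ⟨fun e => ⟨(h1 e).1, (h1 e).1, (h1 e).2⟩, h2⟩
      · rintro ⟨h1, h2⟩; exact ⟨fun e => ⟨(h1 e).1, (h1 e).2.2⟩, h2⟩
    rw [h]
    refine (isOpen_iInter_of_finite fun e => ?_).inter (isOpen_iInter_of_finite fun e => isOpen_lt (hevc e).norm continuous_const)
    have ho : IsOpen {Y : Fin 4 → suFields N n₀ n₁ n₂ n₃ |
        ‖exp (((Y e.2 : suFields N n₀ n₁ n₂ n₃) : FinTorusSite n₀ n₁ n₂ n₃ → Matrix (Fin N) (Fin N) ℂ) e.1) - 1‖ < 1 / 4} :=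
      isOpen_lt ((exp_continuous.comp (hevc e)).sub continuous_const).norm continuous_const
    refine ho.inter (ContinuousOn.isOpen_inter_preimage ?_ ho (isOpen_lt (continuous_id.matrix_trace.norm) continuous_const))
    intro Y hY
    have h1 : ‖exp (((Y e.2 : suFields N n₀ n₁ n₂ n₃) : FinTorusSite n₀ n₁ n₂ n₃ → Matrix (Fin N) (Fin N) ℂ) e.1) - 1‖ < 1 := by
      have := hY; simp only [mem_setOf_eq] at this; linarith
    exact ((analyticAt_mlog h1).continuousAt.comp_of_eq (exp_continuous.comp (hevc e)).continuousAt rfl).continuousWithinAt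
  have hW0 : (0 : Fin 4 → suFields N n₀ n₁ n₂ n₃) ∈ W := by
    have hlog2 : (0 : ℝ) < Real.log 2 := Real.log_pos one_lt_two
    have hmlog1 : mlog (1 : Matrix (Fin N) (Fin N) ℂ) = 0 := by
      have h : mlog (exp (0 : Matrix (Fin N) (Fin N) ℂ)) = 0 := mlog_exp (by rw [norm_zero]; exact hlog2)
      rwa [exp_zero] at h
    simp only [hW, mem_setOf_eq, Pi.zero_apply, ZeroMemClass.coe_zero, exp_zero, sub_self, norm_zero, hmlog1, Matrix.trace_zero]
    exact ⟨fun _ => ⟨by norm_num, by positivity⟩, fun _ => hlog2⟩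
  refine ⟨W, hWo, hW0, fun O hOW hO => ?_⟩
  -- the image of `O` is `Ω ∩ Λ⁻¹' O`
  have heq : {U : FinTorusSite n₀ n₁ n₂ n₃ × Fin 4 → Matrix.specialUnitaryGroup (Fin N) ℂ |
      ∃ Y ∈ O, ∀ e, ((U e : Matrix.specialUnitaryGroup (Fin N) ℂ) : Matrix (Fin N) (Fin N) ℂ) =
        exp (((Y e.2 : suFields N n₀ n₁ n₂ n₃) : FinTorusSite n₀ n₁ n₂ n₃ → Matrix (Fin N) (Fin N) ℂ) e.1) * L e} = Ω ∩ Λ ⁻¹' O := by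
    ext U
    simp only [mem_setOf_eq, mem_inter_iff, mem_preimage]
    constructor
    · rintro ⟨Y, hYO, hUY⟩
      have hYW := hOW hYO
      simp only [hW, mem_setOf_eq] at hYW
      have hflY : ∀ e, fl U e = exp (((Y e.2 : suFields N n₀ n₁ n₂ n₃) : FinTorusSite n₀ n₁ n₂ n₃ → Matrix (Fin N) (Fin N) ℂ) e.1) := by
        intro e; simp only [hfl]; rw [hUY e, Matrix.mul_assoc, hLL e, Matrix.mul_one]
      refine ⟨?_, ?_⟩
      · simp only [hΩ, mem_setOf_eq, hflY]; exact hYW.1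
      · have hΛU : Λ U = Y := by
          have h2 : (fun μ x => mlog (fl U (x, μ))) = suPiIncl N n₀ n₁ n₂ n₃ Y := by
            funext μ x
            rw [hflY (x, μ), suPiIncl_apply]
            exact mlog_exp (hYW.2 (x, μ))
          simp only [hΛ]
          rw [h2, suProj_suPiIncl]
        rwa [hΛU]
    · rintro ⟨hUΩ, hΛO⟩
      refine ⟨Λ U, hΛO, fun e => ?_⟩
      have hsu : fl U e ∈ Matrix.specialUnitaryGroup (Fin N) ℂ := by
        simp only [hfl]
        refine Submonoid.mul_mem _ (U e).2 ?_
        -- `(L e)ᴴ ∈ SU(N)`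
        rw [Matrix.mem_specialUnitaryGroup_iff]
        refine ⟨Matrix.mem_unitaryGroup_iff.2 ?_, by rw [Matrix.det_conjTranspose, (Matrix.mem_specialUnitaryGroup_iff.1 (hL e)).2, star_one]⟩
        simpa only [Matrix.star_eq_conjTranspose, Matrix.conjTranspose_conjTranspose] using hLL' e
      simp only [hΩ, mem_setOf_eq] at hUΩ
      obtain ⟨hskew, htr⟩ := mlog_skew_traceless_of_mem_specialUnitaryGroup hsu (hUΩ e).1 (hUΩ e).2
      have hcoe : ((Λ U e.2 : suFields N n₀ n₁ n₂ n₃) : FinTorusSite n₀ n₁ n₂ n₃ → Matrix (Fin N) (Fin N) ℂ) e.1 = mlog (fl U e) := by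
        simp only [hΛ]; rw [coe_suProj_apply, skewTracelessPart_of_mem hskew htr]
      have hexp : exp (mlog (fl U e)) = fl U e := exp_mlog (by linarith [(hUΩ e).1])
      rw [hcoe]
      calc ((U e : Matrix.specialUnitaryGroup (Fin N) ℂ) : Matrix (Fin N) (Fin N) ℂ) = fl U e * L e := by
            simp only [hfl]; rw [Matrix.mul_assoc, hLL' e, Matrix.mul_one]
        _ = exp (mlog (fl U e)) * L e := (congrArg (· * L e) hexp).symm
  rw [heq]
  exact hΛc.isOpen_inter_preimage hΩo hO

end ExpMul

/-! ## §2 The orbit map is open near the origin (twist-eating ladder) -/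

section Ladder

variable [NeZero N] {m n₂' n₃' : ℕ} {A B : Matrix (Fin N) (Fin N) ℂ} {ω : ℂ} {Γ₂ Γ₃ : Matrix (Fin N) (Fin N) ℂ}

/-- ★★ **THE ORBIT MAP IS OPEN NEAR THE ORIGIN** (twist-eating ladder): there is an open `W ∋ 0` in the `𝔰𝔲` data `(φ, y)` such that the orbit map
`(φ, y) ↦ e^{φ} • (e^{y}·L)` sends every open `O ⊆ W` to an OPEN set of configurations — the inverse-function-theorem chart `Ψ̂` (K15b `sliceChart`)
followed by the open left exponential coordinates. [cite: GarciaperezGonzalezarroyoOkawa2017, §2.3, §2.5] [cite: Helgason2000, Ch. I §1 Thm 1.14 p. 96] -/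
theorem exists_isOpen_forall_isOpen_orbitCfg_image (hAu : A ∈ Matrix.unitaryGroup (Fin N) ℂ) (hBu : B ∈ Matrix.unitaryGroup (Fin N) ℂ)
    (hω : IsPrimitiveRoot ω N) (hAB : A * B = ω • (B * A)) (hNm : 2 ≤ N * (m + 1))
    (hL : ∀ e, ladderField (n₀ := m + 1) (n₁ := m + 1) (n₂ := n₂') (n₃ := n₃') ![A, B, Γ₂, Γ₃] e ∈ Matrix.specialUnitaryGroup (Fin N) ℂ) :
    ∃ W : Set (suFields N (m + 1) (m + 1) n₂' n₃' × realCoulombSlice (ladderField (n₀ := m + 1) (n₁ := m + 1) (n₂ := n₂') (n₃ := n₃') ![A, B, Γ₂, Γ₃])),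
      IsOpen W ∧ 0 ∈ W ∧ ∀ O ⊆ W, IsOpen O → IsOpen (orbitCfg hL '' O) := by
  set L := ladderField (n₀ := m + 1) (n₁ := m + 1) (n₂ := n₂') (n₃ := n₃') ![A, B, Γ₂, Γ₃] with hLdef
  obtain ⟨W₀, hW₀o, hW₀0, hW₀⟩ := exists_isOpen_forall_isOpen_expMul_image (n₀ := m + 1) (n₁ := m + 1) (n₂ := n₂') (n₃ := n₃') hL
  -- the open set where the chart inverts the exponential coordinates
  obtain ⟨W₁, hW₁sub, hW₁o, hW₁0⟩ := mem_nhds_iff.1 (eventually_exp_slicePsiSu_mul hL)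
  set Φ := sliceChart hAu hBu hω hAB hNm hL with hΦ
  set W : Set (suFields N (m + 1) (m + 1) n₂' n₃' × realCoulombSlice L) := W₁ ∩ (Φ.source ∩ Φ ⁻¹' W₀) with hW
  have hWo : IsOpen W := hW₁o.inter (Φ.isOpen_inter_preimage hW₀o)
  have hW0 : (0 : suFields N (m + 1) (m + 1) n₂' n₃' × realCoulombSlice L) ∈ W := by
    refine ⟨hW₁0, zero_mem_sliceChart_source hAu hBu hω hAB hNm hL, ?_⟩
    rw [mem_preimage, hΦ, sliceChart_coe, slicePsiSu_zero fun e => (Matrix.mem_specialUnitaryGroup_iff.1 (hL e)).1]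
    exact hW₀0
  refine ⟨W, hWo, hW0, fun O hOW hO => ?_⟩
  -- `orbitCfg '' O` is the exponential image of the open chart image `Φ '' O ⊆ W₀`
  have hOsrc : O ⊆ Φ.source := fun q hq => (hOW hq).2.1
  have hΦO : IsOpen (Φ '' O) := Φ.isOpen_image_of_subset_source hO hOsrc
  have hΦOW : Φ '' O ⊆ W₀ := by rintro _ ⟨q, hq, rfl⟩; exact (hOW hq).2.2
  have heq : orbitCfg hL '' O = {U : FinTorusSite (m + 1) (m + 1) n₂' n₃' × Fin 4 → Matrix.specialUnitaryGroup (Fin N) ℂ |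
      ∃ Y ∈ Φ '' O, ∀ e, ((U e : Matrix.specialUnitaryGroup (Fin N) ℂ) : Matrix (Fin N) (Fin N) ℂ) =
        exp (((Y e.2 : suFields N (m + 1) (m + 1) n₂' n₃') : FinTorusSite (m + 1) (m + 1) n₂' n₃' → Matrix (Fin N) (Fin N) ℂ) e.1) * L e} := by
    ext U
    simp only [mem_image, mem_setOf_eq]
    constructor
    · rintro ⟨q, hqO, rfl⟩
      refine ⟨Φ q, ⟨q, hqO, rfl⟩, fun e => ?_⟩
      rw [coe_orbitCfg_apply, hΦ, sliceChart_coe]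
      exact (hW₁sub (hOW hqO).1 e.2 e.1).symm
    · rintro ⟨Y, ⟨q, hqO, rfl⟩, hUY⟩
      refine ⟨q, hqO, ?_⟩
      funext e; apply Subtype.ext
      rw [coe_orbitCfg_apply, hUY e, hΦ, sliceChart_coe]
      exact (hW₁sub (hOW hqO).1 e.2 e.1).symm
  rw [heq]
  exact hW₀ _ hΦOW hΦO

/-- ★ **Open at every point near the origin**: for `q ∈ W` the orbit map sends neighbourhoods of `q` onto neighbourhoods of its image
(`𝓝 (orbitCfg q) ≤ map orbitCfg (𝓝 q)`). [cite: GarciaperezGonzalezarroyoOkawa2017, §2.3, §2.5] -/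
theorem exists_isOpen_forall_nhds_le_map_orbitCfg (hAu : A ∈ Matrix.unitaryGroup (Fin N) ℂ) (hBu : B ∈ Matrix.unitaryGroup (Fin N) ℂ)
    (hω : IsPrimitiveRoot ω N) (hAB : A * B = ω • (B * A)) (hNm : 2 ≤ N * (m + 1))
    (hL : ∀ e, ladderField (n₀ := m + 1) (n₁ := m + 1) (n₂ := n₂') (n₃ := n₃') ![A, B, Γ₂, Γ₃] e ∈ Matrix.specialUnitaryGroup (Fin N) ℂ) :
    ∃ W : Set (suFields N (m + 1) (m + 1) n₂' n₃' × realCoulombSlice (ladderField (n₀ := m + 1) (n₁ := m + 1) (n₂ := n₂') (n₃ := n₃') ![A, B, Γ₂, Γ₃])),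
      IsOpen W ∧ 0 ∈ W ∧ ∀ q ∈ W, 𝓝 (orbitCfg hL q) ≤ map (orbitCfg hL) (𝓝 q) := by
  obtain ⟨W, hWo, hW0, hW⟩ := exists_isOpen_forall_isOpen_orbitCfg_image hAu hBu hω hAB hNm hL
  refine ⟨W, hWo, hW0, fun q hq => Filter.le_map fun s hs => ?_⟩
  obtain ⟨O, hOs, hOo, hqO⟩ := mem_nhds_iff.1 (inter_mem hs (hWo.mem_nhds hq))
  exact mem_of_superset ((hW O (fun x hx => (hOs hx).2) hOo).mem_nhds ⟨q, hqO, rfl⟩) (image_mono fun x hx => (hOs hx).1)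

end Ladder

/-! ## §3 The fibred chart map on a product model is open near the origin -/

section Fibred

variable [NeZero N] {m n₂' n₃' : ℕ} {A B : Matrix (Fin N) (Fin N) ℂ} {ω : ℂ} {Γ₂ Γ₃ : Matrix (Fin N) (Fin N) ℂ}
variable {M : Type*} [NormedAddCommGroup M] [InnerProductSpace ℝ M]
variable {V : Type*} [NormedAddCommGroup V] [InnerProductSpace ℝ V]

/-- ★ **The fibred chart map `Ψ = orbitCfg ∘ T ∘ toLp` is open near `0`** (any frame `T` of the `𝔰𝔲` data by an `L²`-product model `M × V`).
[cite: HasenpflugRudolfSprungk2024, §3.1 Assumption 3 (T)] [cite: Bredon1972, Ch. II §§4–5] -/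
theorem exists_isOpen_forall_isOpen_fibredChartMap_image (hAu : A ∈ Matrix.unitaryGroup (Fin N) ℂ) (hBu : B ∈ Matrix.unitaryGroup (Fin N) ℂ)
    (hω : IsPrimitiveRoot ω N) (hAB : A * B = ω • (B * A)) (hNm : 2 ≤ N * (m + 1))
    (hL : ∀ e, ladderField (n₀ := m + 1) (n₁ := m + 1) (n₂ := n₂') (n₃ := n₃') ![A, B, Γ₂, Γ₃] e ∈ Matrix.specialUnitaryGroup (Fin N) ℂ)
    (T : WithLp 2 (M × V) ≃L[ℝ] (suFields N (m + 1) (m + 1) n₂' n₃' ×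
      realCoulombSlice (ladderField (n₀ := m + 1) (n₁ := m + 1) (n₂ := n₂') (n₃ := n₃') ![A, B, Γ₂, Γ₃]))) :
    ∃ W : Set (M × V), IsOpen W ∧ 0 ∈ W ∧ ∀ O ⊆ W, IsOpen O → IsOpen (fibredChartMap hL T '' O) := by
  obtain ⟨W', hW'o, hW'0, hW'⟩ := exists_isOpen_forall_isOpen_orbitCfg_image hAu hBu hω hAB hNm hL
  set H : (M × V) ≃L[ℝ] (suFields N (m + 1) (m + 1) n₂' n₃' ×
      realCoulombSlice (ladderField (n₀ := m + 1) (n₁ := m + 1) (n₂ := n₂') (n₃ := n₃') ![A, B, Γ₂, Γ₃])) :=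
    (WithLp.prodContinuousLinearEquiv 2 ℝ M V).symm.trans T with hH
  have hΨ : fibredChartMap hL T = orbitCfg hL ∘ H := by funext py; rfl
  refine ⟨H ⁻¹' W', hW'o.preimage H.continuous, by rw [mem_preimage, map_zero]; exact hW'0, fun O hOW hO => ?_⟩
  rw [hΨ, image_comp]
  exact hW' _ (by rintro _ ⟨x, hx, rfl⟩; exact hOW hx) (H.toHomeomorph.isOpenMap O hO)

/-- ★ **`Ψ` is open at every point of the window**: `𝓝 (Ψ q) ≤ map Ψ (𝓝 q)` for `q ∈ W` (in particular at `q = 0`: neighbourhoods of the origin of the chart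
are mapped onto neighbourhoods of the background `L`). [cite: HasenpflugRudolfSprungk2024, §3.1 Assumption 3 (T)] -/
theorem exists_isOpen_forall_nhds_le_map_fibredChartMap (hAu : A ∈ Matrix.unitaryGroup (Fin N) ℂ) (hBu : B ∈ Matrix.unitaryGroup (Fin N) ℂ)
    (hω : IsPrimitiveRoot ω N) (hAB : A * B = ω • (B * A)) (hNm : 2 ≤ N * (m + 1))
    (hL : ∀ e, ladderField (n₀ := m + 1) (n₁ := m + 1) (n₂ := n₂') (n₃ := n₃') ![A, B, Γ₂, Γ₃] e ∈ Matrix.specialUnitaryGroup (Fin N) ℂ)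
    (T : WithLp 2 (M × V) ≃L[ℝ] (suFields N (m + 1) (m + 1) n₂' n₃' ×
      realCoulombSlice (ladderField (n₀ := m + 1) (n₁ := m + 1) (n₂ := n₂') (n₃ := n₃') ![A, B, Γ₂, Γ₃]))) :
    ∃ W : Set (M × V), IsOpen W ∧ 0 ∈ W ∧ ∀ q ∈ W, 𝓝 (fibredChartMap hL T q) ≤ map (fibredChartMap hL T) (𝓝 q) := by
  obtain ⟨W, hWo, hW0, hW⟩ := exists_isOpen_forall_isOpen_fibredChartMap_image hAu hBu hω hAB hNm hL T
  refine ⟨W, hWo, hW0, fun q hq => Filter.le_map fun s hs => ?_⟩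
  obtain ⟨O, hOs, hOo, hqO⟩ := mem_nhds_iff.1 (inter_mem hs (hWo.mem_nhds hq))
  exact mem_of_superset ((hW O (fun x hx => (hOs hx).2) hOo).mem_nhds ⟨q, hqO, rfl⟩) (image_mono fun x hx => (hOs hx).1)

end Fibred

/-! ## §4 Orbit tubes are open -/

section Tube

variable {L : FinTorusSite n₀ n₁ n₂ n₃ × Fin 4 → Matrix (Fin N) (Fin N) ℂ}
variable {M : Type*} [NormedAddCommGroup M] [InnerProductSpace ℝ M]
variable {V : Type*} [NormedAddCommGroup V] [InnerProductSpace ℝ V]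

/-- The tube map factors through the fibred chart: `Θ (expGauge (T_M z), y) = Ψ (z, y)` (K18 `fibredChartMap_prodFrame`). [folklore] -/
theorem gaugeAct_expGauge_sliceCfg_eq_fibredChartMap (hL : ∀ e, L e ∈ Matrix.specialUnitaryGroup (Fin N) ℂ)
    (T_M : M ≃L[ℝ] suFields N n₀ n₁ n₂ n₃) (T_V : V ≃L[ℝ] realCoulombSlice L) (z : M) (y : V) :
    gaugeAct (expGauge (T_M z)) (sliceCfg hL (T_V y)) = fibredChartMap hL (prodFrame T_M T_V) (z, y) :=
  (fibredChartMap_prodFrame hL T_M T_V z y).symm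

/-- ★★ **ORBIT TUBES ARE OPEN**: if `Ψ` maps open subsets of `W` to open sets (§3), `Φ ×ˢ B ⊆ W` with `Φ ∋ 0` and `Φ`, `B` open, then the tube
`{k • σ(T_V y) : k ∈ 𝒢, y ∈ B} = Θ(𝒢 × B)` is open in `SU(N)^E` (L21 `isOpen_tube_of_isOpen_image` with `U := e(Φ) ∋ 1`; `Θ(U × B) = Ψ(Φ × B)`).
[cite: DearricottEtAl2014, (Searle) Def. 1.11 and properties (1)–(3), PDF pp. 34–35] [cite: Bredon1972, Ch. II §4] -/
theorem isOpen_tube_of_subset (hL : ∀ e, L e ∈ Matrix.specialUnitaryGroup (Fin N) ℂ)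
    (T_M : M ≃L[ℝ] suFields N n₀ n₁ n₂ n₃) (T_V : V ≃L[ℝ] realCoulombSlice L)
    {W : Set (M × V)} (hW : ∀ O ⊆ W, IsOpen O → IsOpen (fibredChartMap hL (prodFrame T_M T_V) '' O))
    {Φ : Set M} {Bs : Set V} (hΦ : IsOpen Φ) (hΦ0 : (0 : M) ∈ Φ) (hBs : IsOpen Bs) (hsub : Φ ×ˢ Bs ⊆ W) :
    IsOpen ((fun p : (FinTorusSite n₀ n₁ n₂ n₃ → Matrix.specialUnitaryGroup (Fin N) ℂ) × V =>
      gaugeAct p.1 (sliceCfg hL (T_V p.2))) '' (univ ×ˢ Bs)) := by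
  refine isOpen_tube_of_isOpen_image (act := gaugeAct) (σ := fun y => sliceCfg hL (T_V y))
    (Θ := fun p : (FinTorusSite n₀ n₁ n₂ n₃ → Matrix.specialUnitaryGroup (Fin N) ℂ) × V => gaugeAct p.1 (sliceCfg hL (T_V p.2)))
    (fun k => continuous_gaugeAct k) (fun k k' U => gaugeAct_mul k k' U) (fun U => gaugeAct_one U) (fun _ _ => rfl)
    (U := (fun z : M => expGauge (T_M z)) '' Φ) ⟨0, hΦ0, by simp only [map_zero, expGauge_zero]⟩ ?_
  have heq : (fun p : (FinTorusSite n₀ n₁ n₂ n₃ → Matrix.specialUnitaryGroup (Fin N) ℂ) × V => gaugeAct p.1 (sliceCfg hL (T_V p.2))) ''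
      (((fun z : M => expGauge (T_M z)) '' Φ) ×ˢ Bs) = fibredChartMap hL (prodFrame T_M T_V) '' (Φ ×ˢ Bs) := by
    ext U
    simp only [mem_image, mem_prod, Prod.exists]
    constructor
    · rintro ⟨k, y, ⟨⟨z, hz, rfl⟩, hy⟩, rfl⟩
      exact ⟨z, y, ⟨hz, hy⟩, (gaugeAct_expGauge_sliceCfg_eq_fibredChartMap hL T_M T_V z y).symm⟩
    · rintro ⟨z, y, ⟨hz, hy⟩, rfl⟩
      exact ⟨expGauge (T_M z), y, ⟨⟨z, hz, rfl⟩, hy⟩, gaugeAct_expGauge_sliceCfg_eq_fibredChartMap hL T_M T_V z y⟩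
  rw [heq]
  exact hW _ hsub (hΦ.prod hBs)

omit [InnerProductSpace ℝ M] in
/-- Every gauge transform of a slice configuration with parameter in `B` lies in the tube (in particular the whole critical orbit, `y = 0`). [folklore] -/
theorem mem_tube_of_gaugeAct_sliceCfg (hL : ∀ e, L e ∈ Matrix.specialUnitaryGroup (Fin N) ℂ) (T_V : V ≃L[ℝ] realCoulombSlice L) {Bs : Set V}
    (k : FinTorusSite n₀ n₁ n₂ n₃ → Matrix.specialUnitaryGroup (Fin N) ℂ) {y : V} (hy : y ∈ Bs) :
    gaugeAct k (sliceCfg hL (T_V y)) ∈ (fun p : (FinTorusSite n₀ n₁ n₂ n₃ → Matrix.specialUnitaryGroup (Fin N) ℂ) × V =>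
      gaugeAct p.1 (sliceCfg hL (T_V p.2))) '' (univ ×ˢ Bs) :=
  ⟨(k, y), ⟨mem_univ _, hy⟩, rfl⟩

end Tube


/-! ## §5 Distinct vacuum orbits have separated tubes -/

section Distinct

variable [NeZero N] {m m₂ m₃ : ℕ}
variable {V : Type*} [SeminormedAddCommGroup V] [Module ℝ V]
variable {V' : Type*} [SeminormedAddCommGroup V'] [Module ℝ V']

/-- ★ **Distinct centre labels ⇒ separated tubes**: for `(i, j) ≠ (i′, j′)` there is `r > 0` with `k • σ_{ij}(T y) ≠ k′ • σ_{i′j′}(T′ y′)` whenever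
`‖y‖, ‖y′‖ < r` (K2: the labels are gauge invariants, so the two compact orbits are distinct; L21 §3b `exists_pos_forall_act_ne` on the compact gauge
group). [cite: Gonzalezarroyo1998, §4.2] [cite: HasenpflugRudolfSprungk2024, §3.1 Assumption 3 (T)] -/
theorem exists_pos_forall_gaugeAct_sliceCfg_ne {k : ZMod N} (hk : IsUnit k) {A B : Matrix.specialUnitaryGroup (Fin N) ℂ}
    (hAB : B * A * B⁻¹ * A⁻¹ = (suCenter N k : Matrix.specialUnitaryGroup (Fin N) ℂ)) {i j i' j' : ZMod N} (hne : (i, j) ≠ (i', j'))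
    (hL : ∀ e : FinTorusSite (m + 1) (m + 1) (m₂ + 1) (m₃ + 1) × Fin 4, ladderField ![(A : Matrix (Fin N) (Fin N) ℂ), (B : Matrix (Fin N) (Fin N) ℂ),
      centerPhase N i • (1 : Matrix (Fin N) (Fin N) ℂ), centerPhase N j • (1 : Matrix (Fin N) (Fin N) ℂ)] e ∈ Matrix.specialUnitaryGroup (Fin N) ℂ)
    (hL' : ∀ e : FinTorusSite (m + 1) (m + 1) (m₂ + 1) (m₃ + 1) × Fin 4, ladderField ![(A : Matrix (Fin N) (Fin N) ℂ), (B : Matrix (Fin N) (Fin N) ℂ),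
      centerPhase N i' • (1 : Matrix (Fin N) (Fin N) ℂ), centerPhase N j' • (1 : Matrix (Fin N) (Fin N) ℂ)] e ∈ Matrix.specialUnitaryGroup (Fin N) ℂ)
    (T : V ≃L[ℝ] realCoulombSlice (ladderField (n₀ := m + 1) (n₁ := m + 1) (n₂ := m₂ + 1) (n₃ := m₃ + 1)
      ![(A : Matrix (Fin N) (Fin N) ℂ), (B : Matrix (Fin N) (Fin N) ℂ), centerPhase N i • (1 : Matrix (Fin N) (Fin N) ℂ), centerPhase N j • (1 : Matrix (Fin N) (Fin N) ℂ)]))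
    (T' : V' ≃L[ℝ] realCoulombSlice (ladderField (n₀ := m + 1) (n₁ := m + 1) (n₂ := m₂ + 1) (n₃ := m₃ + 1)
      ![(A : Matrix (Fin N) (Fin N) ℂ), (B : Matrix (Fin N) (Fin N) ℂ), centerPhase N i' • (1 : Matrix (Fin N) (Fin N) ℂ), centerPhase N j' • (1 : Matrix (Fin N) (Fin N) ℂ)])) :
    ∃ r : ℝ, 0 < r ∧ ∀ (g g' : FinTorusSite (m + 1) (m + 1) (m₂ + 1) (m₃ + 1) → Matrix.specialUnitaryGroup (Fin N) ℂ) (y : V) (y' : V'),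
      ‖y‖ < r → ‖y'‖ < r → gaugeAct g (sliceCfg hL (T y)) ≠ gaugeAct g' (sliceCfg hL' (T' y')) := by
  refine exists_pos_forall_act_ne (act := gaugeAct) (σ₁ := fun y => sliceCfg hL (T y)) (σ₂ := fun y' => sliceCfg hL' (T' y'))
    continuous_gaugeAct_uncurry ((continuous_sliceCfg hL).comp T.continuous).continuousAt
    ((continuous_sliceCfg hL').comp T'.continuous).continuousAt fun g g' h => hne ?_
  -- equal points on the two orbits force equal labels (K2)
  have h' : gaugeAct g (ladderConfig ![A, B, (suCenter N i : Matrix.specialUnitaryGroup (Fin N) ℂ), (suCenter N j : Matrix.specialUnitaryGroup (Fin N) ℂ)]) =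
      gaugeAct g' (ladderConfig ![A, B, (suCenter N i' : Matrix.specialUnitaryGroup (Fin N) ℂ), (suCenter N j' : Matrix.specialUnitaryGroup (Fin N) ℂ)]) := by
    have h0 := h
    simp only [map_zero, sliceCfg_zero_eq_ladderConfig] at h0
    exact h0
  obtain ⟨hi, hj, -⟩ := ladder_pair_labels_unique_specialUnitary hk hAB h'
  rw [suCenter_coe_injective hi, suCenter_coe_injective hj]

end Distinct

end Summit.QuantumFields.YangMills.Cruxes.IRcof.TwistedSlab

end
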